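import Literature.NumberTheory.EllipticCurves.BSDSelmerParityDokchitserMultiplicityOneProofs
import HarnessLib

/-!
# Step (4) of Dokchitser–Dokchitser's Thm. 4.19: the four closings from the two printed leaves

Proofs-only companion (theorems, no definitions, no named facts; D-0026) of
`BSDSelmerParityDokchitserProofs` for the named fact
`Literature.NumberTheory.EllipticCurves.dokchitser_selmerCorank_baseChange_mod_two_eq`
("`rk_p(E/M₀)` is odd": T. Dokchitser, V. Dokchitser, *On the Birch–Swinnerton-Dyer quotients
modulo squares*, Ann. of Math. 172 (2010), §4.6, step (4) of the proof of Thm. 4.19 = Thm. 1.4).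

After `BSDSelmerParityDokchitserDihedralProofs`, `…Prop417VerbatimProofs` and
`…MultiplicityOneProofs`, everything printed in the proof of step (4) is a theorem of the tree
except its two external inputs, each of which the tree can consume in two printed forms:

* input **A** = Prop. 4.17 of the source (p. 25), either verbatim (`h417V`:
  "`rk_p(A/M) + 2/(p-1)(rk_p(A/L) - rk_p(A/K)) ≡ ord_p C(A/F)/C(A/M) (mod 2)`") or in the form
  invoked on p. 27 (`h417D`: "`rk_p(E/M) + m_ρ ≡ ord_p C(E/F)/C(E/M) (mod 2)`");
* input **B** = the CM-point theorem of Cornut–Vatsal with Tian–Zhang / Nekovář as drawn on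
  p. 27, either in the multiplicity-one form (`hMult`: "`X` contains exactly one copy of the unique
  `(p-1)pⁿ`-dimensional `ℚ_p`-irreducible representation of `Gal(F/M₀)`") or in the growth form
  (`hCV`: "so `m_ρ = pⁿ`", `rk_p(E/M_{n+1}) = rk_p(E/M_n) + (p-1)pⁿ`).

Three of the four closings are in those files
(`dokchitser_selmerCorank_baseChange_mod_two_eq_of_prop417_dihedral_of_hCV`,
`…_of_prop417_verbatim_of_hCV`, `…_of_prop417_verbatim_of_multiplicity_one`); this file records the
fourth, `…_of_prop417_dihedral_of_multiplicity_one` (A in the p. 27 form, B in the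
multiplicity-one form), so that the named fact closes by a one-line application whichever printed
forms of A and B are vendored. Everything here is proved.

## References

* [DokchitserDokchitserAnnals2010] T. Dokchitser, V. Dokchitser, Ann. of Math. 172 (2010),
  567–596 = arXiv:math/0610290: Prop. 4.17 (p. 25), §4.6 proof of Thm. 4.19 (pp. 26–27).
* [CornutVatsal2007] C. Cornut, V. Vatsal, *Nontriviality of Rankin–Selberg L-functions and CM
  points*, Durham 2004 volume, CUP 2007, Thm. 1.5, Thm. 4.2.
* [Nekovar2007] J. Nekovář, *The Euler system method for CM points on Shimura curves*, ibid.,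
  Thm. 3.2.
-/

noncomputable section

open WeierstrassCurve

namespace Literature.NumberTheory.EllipticCurves

/-- **The named fact from Prop. 4.17 in the p. 27 form and the multiplicity-one input**
(Dokchitser–Dokchitser 2010, §4.6, step (4) of the proof of Thm. 4.19 = Thm. 1.4: `rk_p(E/M₀)` is
odd): `h417D` as in `dokchitser_selmerCorank_baseChange_mod_two_eq_of_prop417_dihedral_of_hCV`,
`hMult` as in `hCV_of_multiplicity_one` (which turns it into the growth form `hCV`).
[cite: DokchitserDokchitserAnnals2010, Prop. 4.17 (p. 25) and §4.6, proof of Thm. 4.19 (= Thm. 1.4), pp. 26–27]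
[cite: CornutVatsal2007, Thm. 1.5 and Thm. 4.2] [cite: Nekovar2007, Thm. 3.2] -/
theorem dokchitser_selmerCorank_baseChange_mod_two_eq_of_prop417_dihedral_of_multiplicity_one
    (h417D : ∀ (p : ℕ) [Fact p.Prime], p ≠ 2 →
      ∀ (R : Type) [Field R] [NumberField R] (F : Type) [Field F] [NumberField F] [Algebra R F]
        [IsGalois R F], Nonempty ((F ≃ₐ[R] F) ≃* DihedralGroup p) →
        ∀ (M : Type) [Field M] [NumberField M] [Algebra R M] [Algebra M F] [IsScalarTower R M F],
          Module.finrank R M = 2 →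
          ∀ (E : WeierstrassCurve R) [E.IsElliptic] (mρ : ℕ),
            (E.baseChange F).selmerCorank p = (E.baseChange M).selmerCorank p + (p - 1) * mρ →
              (((E.baseChange M).selmerCorank p + mρ : ℕ) : ℤ) ≡
                padicValRat p ((E.baseChange F).modifiedTamagawaProduct /
                  (E.baseChange M).modifiedTamagawaProduct) [ZMOD 2])
    (hMult : ∀ (W : WeierstrassCurve ℚ) [W.IsElliptic] (p : ℕ) [Fact p.Prime] (hp : p ≠ 2)
      (K : Type) [Field K] [NumberField K], IsImaginaryQuadratic K →
        SatisfiesHeegnerHypothesis (W.conductorNorm ℤ) K →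
          ∀ (κ : ZpExtension K p), κ.IsAnticyclotomic → ∃ n₀ : ℕ, ∀ n ≥ n₀,
            ∀ (σ : (κ.layer (n + 1)) ≃ₐ[K] (κ.layer (n + 1))), orderOf σ = p ^ (n + 1) →
              zpCorank (faithfulSelmerPart (W.baseChange K) (κ.layer (n + 1)) p hp σ n) p =
                (p - 1) * p ^ n) :
    dokchitser_selmerCorank_baseChange_mod_two_eq :=
  dokchitser_selmerCorank_baseChange_mod_two_eq_of_prop417_dihedral_of_hCV h417D
    (hCV_of_multiplicity_one hMult)

end Literature.NumberTheory.EllipticCurves
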